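import Literature.Barriers.Parity.SiegelZeroDichotomyChowlaStep1Holds
import Literature.Barriers.Parity.SiegelZeroDichotomyChowlaStep3Holds
import Literature.Barriers.Parity.SiegelZeroDichotomyChowlaStep5Holds
import HarnessLib

/-!
# Tao–Teräväinen, Corollary 1.8 (ii) — PROVED (`TaoTeravainen2021_chowla_holds`)

Topic `Literature/Barriers/Parity`; the discharge of the named fact
`Literature.Barriers.Parity.TaoTeravainen2021_chowla` (`SiegelZeroDichotomy.lean`): the Chowla
conjecture `|E_{n ≤ x} λ(n+h₁)⋯λ(n+h_k)| ≤ C/log^{1/10} η` in the Siegel-zero range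
`q^{1/2+ε} ≤ x ≤ q^{η^{1/2}}`.

T. Tao, J. Teräväinen, *The Hardy–Littlewood–Chowla conjecture in the presence of a Siegel zero*
(arXiv:2109.06291), Corollary 1.8 (ii) (= Theorem 1.6 at `k = 0`). The proof is the source's §2
strategy at `k = 0`, assembled in `SiegelZeroDichotomyChowla.lean`
(`TaoTeravainen2021_chowla_of_steps`) from the three PROVED steps:
(i) `λ ≈ λ_Siegel` (Proposition 4.2, `TaoTeravainen2021_prop42_k0_holds`, via Proposition 3.5 /
Corollary 3.6 on exceptional primes), (iii) `λ_Siegel ≈ λ♯_Siegel` (Proposition 6.3,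
`TaoTeravainen2021_prop63_k0_holds`, via Lemma 6.1), and (v) the main term (Proposition 8.1,
`TaoTeravainen2021_prop81_k0_holds`, via the Type I bound Lemma 3.7, itself via the twisted Weil
bound proved in `Literature/NumberTheory/LFunctions/HybridCharSum*.lean`).
[cite: TaoTeravainen2021, Corollary 1.8 (ii), Theorem 1.6, §2]
-/

namespace Literature.Barriers.Parity

/-- **Tao–Teräväinen 2022, Corollary 1.8 (ii) — PROVED** (discharging the named fact
`TaoTeravainen2021_chowla`). [cite: TaoTeravainen2021, Corollary 1.8 (ii)] -/
theorem TaoTeravainen2021_chowla_holds : TaoTeravainen2021_chowla :=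
  TaoTeravainen2021_chowla_of_steps TaoTeravainen2021_prop42_k0_holds
    TaoTeravainen2021_prop63_k0_holds TaoTeravainen2021_prop81_k0_holds

end Literature.Barriers.Parity
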